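import Literature.AlgebraicGeometry.Morphisms.CechH1LocalVanishing
import Mathlib.RingTheory.Length
import HarnessLib

/-!
# Transport of `Ȟ¹` along a morphism with isomorphic section maps: injectivity and bijectivity
# of the pullback, equality of lengths along an open immersion

[OURS · support for the kill test `SurfaceTermination` stmt-ResolutionOfSingularities-16488 of the
route `HomologicalConductor` (res-D-pv-045, assembly `stub_pgNonincreasing`, step «transport to the
chart `V ⊆ Z` along `V.ι`»).]  Fact-free, def-free cochain algebra over the tree's Čech files
`Morphisms/CechH1`, `Morphisms/CechH1Pullback`, `Morphisms/CechH1LocalVanishing`.  NOT a statement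
of any manuscript under review; AI-written, AI review is weaker than expert review.

* `cechComapH1_injective_of_comap` — the pullback `Ȟ¹(𝒰, 𝒪_X) → Ȟ¹(g⁻¹𝒰, 𝒪_Y)` along a morphism
  of `A`-schemes `g : Y → X` is INJECTIVE as soon as the section pullbacks are surjective on the
  members `U_i` and injective on the pairwise intersections (e.g. `g_*𝒪_Y = 𝒪_X`); the companion of
  the tree's `CechLocalization.cechComapH1_surjective_of_appLE_bijective`.
* `cechComapH1_bijective_of_isIso_app`, `cechComapH1_bijective_of_isOpenImmersion` — bijectivity
  when the sheaf maps on members, pairwise and triple intersections are isomorphisms, in particular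
  for an OPEN IMMERSION and a family of opens inside its range; hence
  `length_cechH1_preimageFamily_eq_of_isOpenImmersion`: `length_A Ȟ¹(g⁻¹𝒰, 𝒪_Y) = length_A Ȟ¹(𝒰, 𝒪_X)`.

(The change-of-structure-ring and localisation inequalities for lengths are the tree's
`Morphisms/CechH1LengthComparison`, res-L0-w44-stub-4.)

## References
* The Stacks Project, Tag 01ED (Čech complex and its functoriality). [StacksProject]
* U. Görtz, T. Wedhorn, *Algebraic Geometry II* (2023), (21.16), Cor. 21.81. [GortzWedhorn2023]
-/

noncomputable section

open CategoryTheory AlgebraicGeometry Limits TopologicalSpace Opposite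

universe u v

namespace Literature.AlgebraicGeometry.Morphisms

/-! ## Injectivity and bijectivity of the pullback on `Ȟ¹` -/

section Injective

variable {A : Type u} [CommRing A] {X Y : Scheme.{u}} (fX : X ⟶ Spec (.of A))
  (fY : Y ⟶ Spec (.of A)) (g : Y ⟶ X) (hg : g ≫ fX = fY) {ι : Type v} (U : ι → X.Opens)

/-- **The pullback `Ȟ¹(𝒰, 𝒪_X) → Ȟ¹(g⁻¹𝒰, 𝒪_Y)` is injective** when the section pullbacks
`𝒪_X(U_i) → 𝒪_Y(g⁻¹U_i)` are surjective and `𝒪_X(U_i ∩ U_j) → 𝒪_Y(g⁻¹U_i ∩ g⁻¹U_j)` are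
injective: a cocycle on `𝒰` that becomes a coboundary `d⁰b'` on `g⁻¹𝒰` is the coboundary of any
lift `b` of `b'`. [cite: StacksProject, Tag 01ED (Cohomology, Section 20.9)] -/
theorem cechComapH1_injective_of_comap
    (h0 : ∀ i, Function.Surjective (Sections.comap fX fY g hg (le_refl (g ⁻¹ᵁ U i))))
    (h1 : ∀ i j, Function.Injective (Sections.comap fX fY g hg
      (show g ⁻¹ᵁ U i ⊓ g ⁻¹ᵁ U j ≤ g ⁻¹ᵁ (U i ⊓ U j) from fun _ hx => hx))) :
    Function.Injective (cechComapH1 fX fY g hg U) := by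
  rw [injective_iff_map_eq_zero]
  intro x hx
  obtain ⟨⟨c, hc⟩, rfl⟩ := CechH1.mk_surjective fX U x
  rw [cechComapH1_mk_eq_zero_iff] at hx
  obtain ⟨b', hb'⟩ := (mem_cechB1_iff fY _ _).mp hx
  choose b hb using fun i => h0 i (b' i)
  rw [CechH1.mk_eq_zero_iff]
  refine (mem_cechB1_iff fX U c).mpr ⟨b, ?_⟩
  ext i j
  apply h1 i j
  have e := congrFun (congrFun (cechD0_comapC0 fX fY g hg U b) i) j
  have hbb : cechComapC0 fX fY g hg U b = b' := by
    ext i; exact hb i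
  rw [hbb, hb'] at e
  simp only [cechComapC1_apply] at e
  exact e.symm

/-- Along a morphism `g` whose sheaf maps `𝒪_X(V) → 𝒪_Y(g⁻¹V)` are isomorphisms for the members
of the family and their pairwise and triple intersections, the pullback on `Ȟ¹` is BIJECTIVE.
[cite: StacksProject, Tag 01ED (Cohomology, Section 20.9)] -/
theorem cechComapH1_bijective_of_isIso_app
    (h1 : ∀ i, IsIso (g.app (U i))) (h2 : ∀ i j, IsIso (g.app (U i ⊓ U j)))
    (h3 : ∀ i j k, IsIso (g.app (U i ⊓ U j ⊓ U k))) :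
    Function.Bijective (cechComapH1 fX fY g hg U) := by
  have key : ∀ (V : X.Opens) (W : Y.Opens) (e : W ≤ g ⁻¹ᵁ V) (heq : W = g ⁻¹ᵁ V),
      IsIso (g.app V) → Function.Bijective (Sections.comap fX fY g hg e) := by
    intro V W e heq hV
    subst heq
    rw [show (Sections.comap fX fY g hg e : _ → _) = (g.app V).hom from by
      funext s; rw [Sections.comap_apply, Scheme.Hom.appLE_eq_app]]
    exact ConcreteCategory.bijective_of_isIso (g.app V)
  refine ⟨cechComapH1_injective_of_comap fX fY g hg U (fun i => (key _ _ _ rfl (h1 i)).2)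
      (fun i j => (key _ _ _ rfl (h2 i j)).1),
    CechLocalization.cechComapH1_surjective_of_appLE_bijective fX fY g hg U
      (fun i j => key _ _ _ rfl (h2 i j)) (fun i j k => (key _ _ _ rfl (h3 i j k)).1)⟩

/-- **Open immersions**: for `g : Y → X` an open immersion and a family `𝒰` of opens of `X` inside
the range of `g`, the pullback `Ȟ¹(𝒰, 𝒪_X) → Ȟ¹(g⁻¹𝒰, 𝒪_Y)` is bijective.
[cite: StacksProject, Tag 01ED (Cohomology, Section 20.9)] -/
theorem cechComapH1_bijective_of_isOpenImmersion [IsOpenImmersion g]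
    (hU : ∀ i, U i ≤ g.opensRange) : Function.Bijective (cechComapH1 fX fY g hg U) :=
  cechComapH1_bijective_of_isIso_app fX fY g hg U (fun i => g.isIso_app _ (hU i))
    (fun i _ => g.isIso_app _ (inf_le_left.trans (hU i)))
    (fun i _ _ => g.isIso_app _ ((inf_le_left.trans inf_le_left).trans (hU i)))

include hg in
/-- Hence the lengths agree: `length_A Ȟ¹(g⁻¹𝒰, 𝒪_Y) = length_A Ȟ¹(𝒰, 𝒪_X)` for an open
immersion `g` and a family inside its range. [cite: StacksProject, Tag 01ED (Cohomology, Section 20.9)] -/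
theorem length_cechH1_preimageFamily_eq_of_isOpenImmersion [IsOpenImmersion g]
    (hU : ∀ i, U i ≤ g.opensRange) :
    Module.length A (CechH1 fY (preimageFamily g U)) = Module.length A (CechH1 fX U) :=
  (LinearEquiv.ofBijective _ (cechComapH1_bijective_of_isOpenImmersion fX fY g hg U hU)).length_eq.symm

end Injective

end Literature.AlgebraicGeometry.Morphisms

end
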